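import Literature.NumberTheory.GaloisCohomology.PoitouTateRestrictedRamificationNatural
import Literature.NumberTheory.GaloisRepresentations.ContinuousShapiroOpenCoinducedDescent
import Literature.NumberTheory.GaloisRepresentations.LocalCanonicalFundamentalClass
import HarnessLib

/-!
# The natural restricted Poitou–Tate Ш-duality implies the per-module one
# (`poitouTate_shaRestricted_tateDual_natural K → poitouTate_shaRestricted_tateDual K`)

Theorems only (no definition, no named fact, no `sorry`, no instance).  The sibling file
`PoitouTateRestrictedRamificationNatural.lean` records Milne I Thm. 4.10 (a) = Harari Thm. 17.13 (b)
WITH the canonicity of its pairing as the named fact `poitouTate_shaRestricted_tateDual_natural K`: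
one family of perfect pairings `Ш²_S(K, M) × Ш¹_S(K, M^D) → ℚ/ℤ`, natural for adjoint pairs of module
maps.  The older per-module rendering `poitouTate_shaRestricted_tateDual K`
(`PoitouTateRestrictedRamification.lean` §2) asserts, module by module, finiteness and a perfect
pairing with values in `ℤ/n` (`n · M = 0`).  This file proves that the natural fact IMPLIES the
per-module one (`poitouTate_shaRestricted_tateDual_of_natural`), so that a consumer of both carries ONE
textbook name in its trust base, not two.  The passage `ℚ/ℤ ↝ ℤ/n` is elementary:

* §1 `exists_zmodToQmodZ_comp_eq` — an additive map from an `n`-torsion group to `ℚ/ℤ` factors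
  (uniquely) through `(1/n)ℤ/ℤ = ℤ/n ↪ ℚ/ℤ` (`zmodToQmodZ`, `UnitsLayer.mem_range_zmodToQmodZ_of_nsmul_eq_zero`);
  `exists_zmod_pairing_of_addCircle_pairing` — a perfect `ℚ/ℤ`-valued pairing `X × Y → ℚ/ℤ` with `Y`
  of exponent `n` yields a perfect `ℤ/n`-valued one (both adjoints bijective).
* §2 `nsmul_restrictedCohomology_tateDual_eq_zero` — `Hⁱ(G_S, (M^D)^{N_S})` is killed by `n`
  (`M^D = Hom(M, μₙ)` is, and `Hⁱ` of an `n`-torsion module is `n`-torsion: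
  `ContinuousRep.nsmul_eq_zero_of_forall`); the per-module `ℚ/ℤ`-valued duality
  `finite_and_exists_perfect_shaRestricted_pairing_of_natural`; the right non-degeneracy one-liner
  `eq_zero_of_forall_shaRestricted_pairing_eq_zero` ("(D-a)" of the Greenberg-tower consumer); and
  `poitouTate_shaRestricted_tateDual_of_natural`.

Nothing is proved here about the duality itself (both facts remain hypotheses); no case of BSD.
AI formalisation, weaker than expert review; the statements are established only by the kernel check.

## References
* J. S. Milne, *Arithmetic Duality Theorems*, 2nd ed. (2006), I Thm. 4.10 (a) (p. 57), §4 p. 65.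
  [MilneADT2006]
* D. Harari, *Galois Cohomology and Class Field Theory*, Universitext (2020), Thm. 17.13 (b) (p. 294).
  [Harari2020]
* J.-P. Serre, *Local Fields* (1979), Ch. XIII §3 (the `n`-torsion of `ℚ/ℤ`). [SerreLocalFields1979]
-/

noncomputable section

open Function NumberField Field IsDedekindDomain CategoryTheory
open scoped NumberField

namespace Literature.NumberTheory.GaloisCohomology

open Literature.NumberTheory.GaloisRepresentations
open Literature.NumberTheory.GaloisRepresentations.DiscreteGaloisModule (TateDual tateDual
  restrictedCohomology restrictedLocalization shaRestricted)
open Literature.AnabelianGeometry.AbsoluteAnabelian.Prop121vii (zmodToQmodZ zmodToQmodZ_injective)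

/-! ## §1. `ℚ/ℤ`-valued versus `ℤ/n`-valued pairings on groups of exponent `n` -/

section ZModOfAddCircle

variable {X Y : Type*} [AddCommGroup X] [AddCommGroup Y] (n : ℕ) [NeZero n]

/-- An additive map from a group of exponent dividing `n` to `ℚ/ℤ` takes values in `(1/n)ℤ/ℤ`, hence
factors through `ℤ/n ↪ ℚ/ℤ`. [cite: SerreLocalFields1979, Ch. XIII §3 Cor. 2 to Prop. 7] -/
theorem exists_zmodToQmodZ_comp_eq (hY : ∀ y : Y, n • y = 0) (f : Y →+ AddCircle (1 : ℚ)) :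
    ∃ g : Y →+ ZMod n, (zmodToQmodZ n).comp g = f := by
  have hmem : ∀ y : Y, f y ∈ Set.range (zmodToQmodZ n) := fun y =>
    UnitsLayer.mem_range_zmodToQmodZ_of_nsmul_eq_zero n (f y) (by rw [← map_nsmul, hY y, map_zero])
  choose g hg using hmem
  refine ⟨{ toFun := g, map_zero' := ?_, map_add' := fun y y' => ?_ }, AddMonoidHom.ext fun y => hg y⟩
  · exact zmodToQmodZ_injective n (by rw [hg, map_zero, map_zero])
  · exact zmodToQmodZ_injective n (by rw [hg, map_add, map_add, hg, hg])

/-- The factorisation through `ℤ/n ↪ ℚ/ℤ` is unique. [cite: SerreLocalFields1979, Ch. XIII §3 Cor. 2 to Prop. 7] -/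
theorem zmodToQmodZ_comp_injective :
    Injective fun g : Y →+ ZMod n => (zmodToQmodZ n).comp g := fun _ _ h =>
  (AddMonoidHom.cancel_left (zmodToQmodZ_injective n)).1 h

/-- **A perfect `ℚ/ℤ`-valued pairing `X × Y → ℚ/ℤ` with `Y` of exponent dividing `n` yields a perfect
`ℤ/n`-valued pairing** (compose with the inverse of `ℤ/n ≅ (1/n)ℤ/ℤ ⊆ ℚ/ℤ` on values; both adjoints
stay bijective). [cite: SerreLocalFields1979, Ch. XIII §3 Cor. 2 to Prop. 7] -/
theorem exists_zmod_pairing_of_addCircle_pairing (hY : ∀ y : Y, n • y = 0)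
    (B : X →+ Y →+ AddCircle (1 : ℚ)) (hB : Bijective B) (hB' : Bijective B.flip) :
    ∃ b : X →+ Y →+ ZMod n, Bijective b ∧ Bijective b.flip := by
  have hex : ∀ x : X, ∃ g : Y →+ ZMod n, (zmodToQmodZ n).comp g = B x := fun x =>
    exists_zmodToQmodZ_comp_eq n hY (B x)
  choose g hg using hex
  have hinj := zmodToQmodZ_comp_injective (Y := Y) n
  let b : X →+ Y →+ ZMod n :=
    { toFun := g
      map_zero' := hinj (by simp only [hg, map_zero, AddMonoidHom.comp_zero])
      map_add' := fun x x' => hinj (by simp only [hg, map_add, AddMonoidHom.comp_add]) }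
  have hb : ∀ x y, zmodToQmodZ n (b x y) = B x y := fun x y => by
    change zmodToQmodZ n (g x y) = B x y
    rw [← AddMonoidHom.comp_apply, hg]
  refine ⟨b, ⟨fun x x' h => hB.1 ?_, fun f => ?_⟩, ⟨fun y y' h => hB'.1 ?_, fun f => ?_⟩⟩
  · -- injectivity of `b`
    refine AddMonoidHom.ext fun y => ?_
    rw [← hb, ← hb, h]
  · -- surjectivity of `b`
    obtain ⟨x, hx⟩ := hB.2 ((zmodToQmodZ n).comp f)
    refine ⟨x, hinj ?_⟩
    change (zmodToQmodZ n).comp (b x) = (zmodToQmodZ n).comp f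
    rw [← hx]
    exact AddMonoidHom.ext fun y => hb x y
  · -- injectivity of `b.flip`
    refine AddMonoidHom.ext fun x => ?_
    rw [AddMonoidHom.flip_apply, AddMonoidHom.flip_apply, ← hb, ← hb]
    exact congrArg _ (DFunLike.congr_fun h x)
  · -- surjectivity of `b.flip`
    obtain ⟨y, hy⟩ := hB'.2 ((zmodToQmodZ n).comp f)
    refine ⟨y, AddMonoidHom.ext fun x => zmodToQmodZ_injective n ?_⟩
    rw [AddMonoidHom.flip_apply, hb, ← AddMonoidHom.flip_apply, hy, AddMonoidHom.comp_apply]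

end ZModOfAddCircle

/-! ## §2. Consequences of the natural fact -/

section Consequences

variable {K : Type} [Field K]

/-- An element of `Hom(M, μₙ)` (additive notation) is killed by `n`. [cite: MilneADT2006, Ch. I §2 (`M^D`)] -/
theorem nsmul_tateDual_eq_zero {M : Type} [AddCommGroup M] (n : ℕ) (φ : TateDual K M n) : n • φ = 0 := by
  refine DiscreteGaloisModule.TateDual.ext fun m => ?_
  have hval : ∀ t : Additive (rootsOfUnity n (AlgebraicClosure K)), n • t = 0 := fun t => by
    apply Additive.toMul.injective
    rw [toMul_nsmul, toMul_zero]
    exact Subtype.ext (by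
      rw [Subgroup.coe_pow, Subgroup.coe_one]
      exact (mem_rootsOfUnity n _).1 (Additive.toMul t).2)
  have key : ∀ k : ℕ, (k • φ) m = k • φ m := fun k => by
    induction k with
    | zero => rw [zero_nsmul, zero_nsmul, DiscreteGaloisModule.TateDual.zero_apply]
    | succ k ih => rw [succ_nsmul, succ_nsmul, DiscreteGaloisModule.TateDual.add_apply, ih]
  rw [key, hval, DiscreteGaloisModule.TateDual.zero_apply]

/-- **`Hⁱ(G_S, (M^D)^{N_S})` is killed by `n`**: the coefficients `M^D = Hom(M, μₙ)` are, and the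
cohomology of an `n`-torsion module is `n`-torsion. [cite: MilneADT2006, Ch. I §2 and §4 (p. 56)] -/
theorem nsmul_restrictedCohomology_tateDual_eq_zero {M : Type} [AddCommGroup M] [TopologicalSpace M]
    [DiscreteTopology M] [Finite M] (ρ : DiscreteGaloisModule K M) (S : Set (HeightOneSpectrum (𝓞 K)))
    (n i : ℕ) (c : restrictedCohomology (ρ.tateDual n) S i) : n • c = 0 :=
  ContinuousRep.nsmul_eq_zero_of_forall _ n (fun v => Subtype.ext (by
    rw [Submodule.coe_smul, natCast_zsmul, nsmul_tateDual_eq_zero, Submodule.coe_zero])) i c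

variable [NumberField K]

/-- The same for the subgroup `Ш¹_S(K, M^D)` (or any subgroup of `Hⁱ(G_S, (M^D)^{N_S})`).
[cite: MilneADT2006, Ch. I, Thm. 4.10 (a) (p. 57)] -/
theorem nsmul_shaRestricted_tateDual_eq_zero {M : Type} [AddCommGroup M] [TopologicalSpace M]
    [DiscreteTopology M] [Finite M] (ρ : DiscreteGaloisModule K M) (S : Set (HeightOneSpectrum (𝓞 K)))
    (n i : ℕ) (z : ↥(shaRestricted (ρ.tateDual n) S i)) : n • z = 0 :=
  Subtype.ext (by
    rw [AddSubgroupClass.coe_nsmul, nsmul_restrictedCohomology_tateDual_eq_zero, AddSubgroup.coe_zero])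

/-- **The per-module duality, `ℚ/ℤ`-valued** (Thm. 4.10 (a) / 17.13 (b) for one module, from the
natural form): under the printed hypotheses `Ш¹_S(K, M^D)` and `Ш²_S(K, M)` are finite and there is a
pairing `Ш²_S(K, M) × Ш¹_S(K, M^D) → ℚ/ℤ` both of whose adjoints are bijective.
[cite: MilneADT2006, Ch. I, Thm. 4.10 (a) (p. 57)] [cite: Harari2020, Thm. 17.13 (b) (p. 294)] -/
theorem finite_and_exists_perfect_shaRestricted_pairing_of_natural
    (h : poitouTate_shaRestricted_tateDual_natural K) (S : Set (HeightOneSpectrum (𝓞 K))) (n : ℕ)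
    [NeZero n] (M : Type) [AddCommGroup M] [TopologicalSpace M] [DiscreteTopology M] [Finite M]
    (ρ : DiscreteGaloisModule K M) (hn : ∀ m : M, n • m = 0) (hur : GaloisRep.IsUnramifiedOutside S ρ)
    (hS : ∀ v : HeightOneSpectrum (𝓞 K), ((Nat.card M : ℕ) : 𝓞 K) ∈ v.asIdeal → v ∈ S) :
    Finite (shaRestricted (ρ.tateDual n) S 1) ∧ Finite (shaRestricted ρ S 2) ∧
      ∃ b : ↥(shaRestricted ρ S 2) →+ ↥(shaRestricted (ρ.tateDual n) S 1) →+ AddCircle (1 : ℚ),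
        Bijective b ∧ Bijective b.flip := by
  obtain ⟨B, hP, -⟩ := h S
  obtain ⟨h1, h2, hb, hb'⟩ := hP n M ρ hn hur hS
  exact ⟨h1, h2, B n M ρ, hb, hb'⟩

/-- **Right non-degeneracy** in the form a tower consumer uses (Greenberg 2010 §2.1 (6), "(D-a)"): a
class `z ∈ Ш¹_S(K, M^D)` pairing to zero with all of `Ш²_S(K, M)` is zero, whenever the adjoint
`Ш¹_S(K, M^D) → Hom(Ш²_S(K, M), ℚ/ℤ)` is injective. [cite: MilneADT2006, Ch. I, Thm. 4.10 (a) (p. 57)] -/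
theorem eq_zero_of_forall_shaRestricted_pairing_eq_zero {X Y C : Type*} [AddCommGroup X]
    [AddCommGroup Y] [AddCommGroup C] (b : X →+ Y →+ C) (hb : Injective b.flip) (z : Y)
    (hz : ∀ x : X, b x z = 0) : z = 0 := by
  refine (injective_iff_map_eq_zero b.flip).1 hb z (AddMonoidHom.ext fun x => ?_)
  rw [AddMonoidHom.flip_apply, hz x, AddMonoidHom.zero_apply]

/-- **The natural fact implies the per-module fact**:
`poitouTate_shaRestricted_tateDual_natural K → poitouTate_shaRestricted_tateDual K` (the `ℚ/ℤ`-valued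
perfect pairing of (P) becomes a `ℤ/n`-valued perfect pairing because `Ш¹_S(K, M^D)` has exponent
dividing `n`). [cite: MilneADT2006, Ch. I, Thm. 4.10 (a) (p. 57)] [cite: Harari2020, Thm. 17.13 (b) (p. 294)] -/
theorem poitouTate_shaRestricted_tateDual_of_natural (h : poitouTate_shaRestricted_tateDual_natural K) :
    poitouTate_shaRestricted_tateDual K := by
  intro S n _ M _ _ _ _ ρ hn hur hS
  obtain ⟨B, hP, -⟩ := h S
  obtain ⟨h1, h2, hb, hb'⟩ := hP n M ρ hn hur hS
  exact ⟨h1, h2, exists_zmod_pairing_of_addCircle_pairing n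
    (nsmul_shaRestricted_tateDual_eq_zero ρ S n 1) (B n M ρ) hb hb'⟩

end Consequences

end Literature.NumberTheory.GaloisCohomology

end
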